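import Literature.NumberTheory.Automorphic.UnitaryDualPairDoubledLineAdelicAction
import HarnessLib

/-!
# The adelic `W`-side of the doubled pair in the SUM MODEL `Sp(T ⊕ −T)` on `(𝔸_F^n ⊕ 𝔸_F^n)²`

Topic `NumberTheory/Automorphic`; namespace `Literature.NumberTheory.Automorphic.UnitaryGroup` (sequel of
★ `UnitaryDualPairDoubledLineAdelicAction`).  KERNEL only: proved theorems, no definition, no named fact.

The skeleton of the E-2 Siegel–Weil line reads the doubled pair `(U(J_V), U(T_W ⊕ −T_W))` through the pair embedding
`ι_{eD} = toSp(eD)` into `Sp(𝕎□_𝔸)` on `(Fin (n+n) → 𝔸_F)²` (Gram `reindex eD eD (T_V ⊗ (T_W ⊕ −T_W))`), whereas the doubled-frame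
operator laws (★ `Weil1964/AdelicDoublingGeometricFrameBorel`) take their `W`-side element as `g : Sp𝕎₂`, the symplectic group of the
SUM MODEL `T ⊕ −T` on `(Fin n ⊕ Fin n → 𝔸_F)²`, `T = reindex e e (T_V ⊗ T_W)` the Gram matrix of `𝕎 = Res(V ⊗ W)`, with VECTOR
hypotheses `g(Sum.elim x₁ x₂, Sum.elim y₁ y₂) = …`.  This file supplies the element `g` for EVERY adelic `A ∈ U(T_W ⊕ −T_W)(𝔸_F)` at once,
as a GROUP HOMOMORPHISM:

* `reindex_doubledFrame_kronecker_eq_fromBlocks` — the Gram identity `reindex E₁ E₁ (T_V ⊗ (T_W ⊕ −T_W)) = T ⊕ −T` for the doubled frame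
  `E₁ : Fin N × Fin (1+1) ≃ Fin n ⊕ Fin n` (`(i,0) ↦ inl (e(i,0))`, `(i,1) ↦ inr (e(i,0))`; ★ `doubledFrame_apply_zero/one`);
* **`exists_sumModelHom`** — there is a hom `jS : U(T_W ⊕ −T_W)(𝔸_F) →* Sp𝕎₂` with
  (i) `spReindex finSumFinEquiv (T ⊕ −T) (jS A) = ι_{eD}(1 ⊗ A)` as automorphisms of `𝕎□_𝔸` (so `jS` IS the `W`-member of the
  skeleton's pair embedding, read in the Sum model), and
  (ii) `(jS A)(Sum.elim x₁ x₂, Sum.elim y₁ y₂) = (Sum.elim (P₀₀x₁ + P₀₁x₂ + d(Q₀₀y₁ + Q₀₁y₂)) (…), Sum.elim (Q₀₀x₁ + Q₀₁x₂ + P₀₀y₁ + P₀₁y₂) (…))`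
  for `P = re_𝔸 A`, `Q = im_𝔸 A` (★ `toSp_adelicInr_apply_reindexW_sumElim`) — whence the vector hypotheses `hD′`/`hN′` of the frame laws
  for `jS (d(u,w))`, `jS (n(δy))` and their inverses (`map_inv`) follow from ★ `coe_cayley_conj_glDiagonal_adelic` ∕ ★ `coe_cayley_conj_upper`.

References: S. Gelbart, I. Piatetski-Shapiro, S. Rallis, LNM 1254 (1987), Part A §2 pp. 7–9; M. Harris, S. Kudla, W. Sweet,
J. AMS 9 (1996), §1 (1.2), (1.11); S. Gelbart, J. Rogawski, Invent. Math. 105 (1991), §3.1 p. 454.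

Written for the Hodge-CM cell `pub/hodgecm-mathlib`, floor 0, crux H413 (stmt-HodgeConjecture-24833), E-2 child line `F0_E2SiegelWeilWeilRange`,
SW2c-BOUND sheet v1 (junction (J)/(RAY)/(IMPL-proj): A-p16 (g18) share of the `j` declaration, 2026-08-31).
HC_CM is proved only modulo the printed citations until rung 0 closes; this file discharges none of them.
-/

set_option autoImplicit false

noncomputable section

open scoped Kronecker Matrix NNReal
open NumberField
open Literature.RepresentationTheory.HeisenbergGroup
open Literature.NumberTheory.Weil1964

namespace Literature.NumberTheory.Automorphic

namespace UnitaryGroup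

section SumModel

variable (F E : Type) [Field F] [NumberField F] [Field E] [NumberField E] [Algebra F E] [Algebra.IsQuadraticExtension F E]
  (c : E ≃ₐ[F] E) {δ : E} (hcδ : c δ = -δ) (hδ : δ ≠ 0) {d : F} (hd : δ * δ = algebraMap F E d)
  (N : ℕ) {n : ℕ} (e : Fin N × Fin 1 ≃ Fin n)
  {TV : Matrix (Fin N) (Fin N) F} (TW : Matrix (Fin 1) (Fin 1) F) (hV : TV.IsSymm)
  (hW2 : (Matrix.reindex finSumFinEquiv finSumFinEquiv (Matrix.fromBlocks TW 0 0 (-TW))).IsSymm)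

/-- **The Gram identity of the doubled frame**: `reindex E₁ E₁ (T_V ⊗ (T_W ⊕ −T_W)) = T ⊕ −T` over `𝔸_F`, with
`T = reindex e e (T_V ⊗ T_W)` (= ★ `adelicGram F e T_V T_W`) and `E₁ : Fin N × Fin (1+1) ≃ Fin n ⊕ Fin n` the doubled frame.
[cite: GelbartPiatetskishapiroRallis1987, Part A §2 pp. 7–9] -/
theorem reindex_doubledFrame_kronecker_eq_fromBlocks :
    Matrix.reindex
        (((Equiv.prodCongr (Equiv.refl (Fin N)) finSumFinEquiv.symm).trans (Equiv.prodSumDistrib (Fin N) (Fin 1) (Fin 1))).trans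
          (Equiv.sumCongr e e))
        (((Equiv.prodCongr (Equiv.refl (Fin N)) finSumFinEquiv.symm).trans (Equiv.prodSumDistrib (Fin N) (Fin 1) (Fin 1))).trans
          (Equiv.sumCongr e e))
        (TV.map (algebraMap F (AdeleRing (𝓞 F) F)) ⊗ₖ
          ((Matrix.reindex finSumFinEquiv finSumFinEquiv (Matrix.fromBlocks TW 0 0 (-TW))).map (algebraMap F (AdeleRing (𝓞 F) F)))) =
      Matrix.fromBlocks (GelbartRogawski1991.UnitaryDualPair.adelicGram F e TV TW) 0 0
        (-GelbartRogawski1991.UnitaryDualPair.adelicGram F e TV TW) := by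
  set E₁ : Fin N × Fin (1 + 1) ≃ Fin n ⊕ Fin n :=
    (((Equiv.prodCongr (Equiv.refl (Fin N)) finSumFinEquiv.symm).trans (Equiv.prodSumDistrib (Fin N) (Fin 1) (Fin 1))).trans
      (Equiv.sumCongr e e)) with hE₁
  have h0 : ∀ i : Fin N, E₁ (i, 0) = Sum.inl (e (i, 0)) := fun i => doubledFrame_apply_zero e i
  have h1 : ∀ i : Fin N, E₁ (i, 1) = Sum.inr (e (i, 0)) := fun i => doubledFrame_apply_one e i
  have he0 : ∀ j : Fin n, e ((e.symm j).1, 0) = j := fun j => by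
    have : ((e.symm j).1, (0 : Fin 1)) = e.symm j := Prod.ext rfl (Subsingleton.elim _ _)
    rw [this, Equiv.apply_symm_apply]
  have hs0 : ∀ j : Fin n, E₁.symm (Sum.inl j) = ((e.symm j).1, 0) := fun j => by
    rw [Equiv.symm_apply_eq, h0, he0]
  have hs1 : ∀ j : Fin n, E₁.symm (Sum.inr j) = ((e.symm j).1, 1) := fun j => by
    rw [Equiv.symm_apply_eq, h1, he0]
  have hf0 : ((finSumFinEquiv : Fin 1 ⊕ Fin 1 ≃ Fin (1 + 1)).symm 0) = Sum.inl 0 := rfl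
  have hf1 : ((finSumFinEquiv : Fin 1 ⊕ Fin 1 ≃ Fin (1 + 1)).symm 1) = Sum.inr 0 := rfl
  have h2 : ∀ j : Fin n, (e.symm j).2 = 0 := fun j => Subsingleton.elim _ _
  ext a b
  rcases a with j | j <;> rcases b with j' | j' <;>
    simp only [Matrix.reindex_apply, Matrix.submatrix_apply, hs0, hs1, Matrix.kroneckerMap_apply, Matrix.map_apply, hf0, hf1, h2,
      Matrix.fromBlocks_apply₁₁, Matrix.fromBlocks_apply₁₂, Matrix.fromBlocks_apply₂₁, Matrix.fromBlocks_apply₂₂, Matrix.zero_apply,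
      Matrix.neg_apply, map_zero, mul_zero, map_neg, mul_neg]

/-- (i) for the composite hom `inclusion ∘ spReindex E₁ ∘ adelicPairToSymplectic ∘ adelicInr` (private; split off to keep
each declaration within the default heartbeat budget). [folklore] -/
private theorem spReindex_inclusion_spReindex_apply
    (hS : symplecticGroup (polar (Matrix.toLinearMap₂' (AdeleRing (𝓞 F) F) (Matrix.reindex
        (((Equiv.prodCongr (Equiv.refl (Fin N)) finSumFinEquiv.symm).trans (Equiv.prodSumDistrib (Fin N) (Fin 1) (Fin 1))).trans
          (Equiv.sumCongr e e))
        (((Equiv.prodCongr (Equiv.refl (Fin N)) finSumFinEquiv.symm).trans (Equiv.prodSumDistrib (Fin N) (Fin 1) (Fin 1))).trans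
          (Equiv.sumCongr e e))
        (TV.map (algebraMap F (AdeleRing (𝓞 F) F)) ⊗ₖ
          ((Matrix.reindex finSumFinEquiv finSumFinEquiv (Matrix.fromBlocks TW 0 0 (-TW))).map (algebraMap F (AdeleRing (𝓞 F) F))))))) ≤
      symplecticGroup (polar (Matrix.toLinearMap₂' (AdeleRing (𝓞 F) F)
        (Matrix.fromBlocks (GelbartRogawski1991.UnitaryDualPair.adelicGram F e TV TW) 0 0
          (-GelbartRogawski1991.UnitaryDualPair.adelicGram F e TV TW)))))
    (A : adelic F E c (1 + 1) ((Matrix.reindex finSumFinEquiv finSumFinEquiv (Matrix.fromBlocks TW 0 0 (-TW))).map (algebraMap F E)))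
    (v : (Fin (n + n) → AdeleRing (𝓞 F) F) × (Fin (n + n) → AdeleRing (𝓞 F) F)) :
    ((spReindex (finSumFinEquiv : Fin n ⊕ Fin n ≃ Fin (n + n))
        (Matrix.fromBlocks (GelbartRogawski1991.UnitaryDualPair.adelicGram F e TV TW) 0 0
          (-GelbartRogawski1991.UnitaryDualPair.adelicGram F e TV TW))
        (Subgroup.inclusion hS (spReindex
          (((Equiv.prodCongr (Equiv.refl (Fin N)) finSumFinEquiv.symm).trans (Equiv.prodSumDistrib (Fin N) (Fin 1) (Fin 1))).trans
            (Equiv.sumCongr e e)) _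
          (adelicPairToSymplectic F E c N (1 + 1) hcδ hδ hd hV hW2 rfl rfl
            (adelicInr F E c N (1 + 1) (TV.map (algebraMap F E))
              ((Matrix.reindex finSumFinEquiv finSumFinEquiv (Matrix.fromBlocks TW 0 0 (-TW))).map (algebraMap F E)) A)))) :
        symplecticGroup (polar (Matrix.toLinearMap₂' (AdeleRing (𝓞 F) F)
          (Matrix.reindex finSumFinEquiv finSumFinEquiv
            (Matrix.fromBlocks (GelbartRogawski1991.UnitaryDualPair.adelicGram F e TV TW) 0 0
              (-GelbartRogawski1991.UnitaryDualPair.adelicGram F e TV TW)))))) :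
      ((Fin (n + n) → AdeleRing (𝓞 F) F) × (Fin (n + n) → AdeleRing (𝓞 F) F)) ≃ₗ[AdeleRing (𝓞 F) F]
        ((Fin (n + n) → AdeleRing (𝓞 F) F) × (Fin (n + n) → AdeleRing (𝓞 F) F))) v =
    ((GelbartRogawski1991.UnitaryDualPair.toSp F E c N (1 + 1)
        (((Equiv.prodCongr (Equiv.refl (Fin N)) finSumFinEquiv.symm).trans (Equiv.prodSumDistrib (Fin N) (Fin 1) (Fin 1))).trans
          ((Equiv.sumCongr e e).trans finSumFinEquiv))
        (TV.map (algebraMap F E)) ((Matrix.reindex finSumFinEquiv finSumFinEquiv (Matrix.fromBlocks TW 0 0 (-TW))).map (algebraMap F E))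
        hcδ hδ hd hV hW2 rfl rfl
        (adelicInr F E c N (1 + 1) (TV.map (algebraMap F E))
          ((Matrix.reindex finSumFinEquiv finSumFinEquiv (Matrix.fromBlocks TW 0 0 (-TW))).map (algebraMap F E)) A) :
        symplecticGroup (polar (Weil1964.adelicForm F (Fin (n + n))
          (GelbartRogawski1991.UnitaryDualPair.adelicGram F
            (((Equiv.prodCongr (Equiv.refl (Fin N)) finSumFinEquiv.symm).trans (Equiv.prodSumDistrib (Fin N) (Fin 1) (Fin 1))).trans
              ((Equiv.sumCongr e e).trans finSumFinEquiv)) TV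
            (Matrix.reindex finSumFinEquiv finSumFinEquiv (Matrix.fromBlocks TW 0 0 (-TW))))))) :
      ((Fin (n + n) → AdeleRing (𝓞 F) F) × (Fin (n + n) → AdeleRing (𝓞 F) F)) ≃ₗ[AdeleRing (𝓞 F) F]
        ((Fin (n + n) → AdeleRing (𝓞 F) F) × (Fin (n + n) → AdeleRing (𝓞 F) F))) v := by
  rw [coe_spReindex_apply, Subgroup.coe_inclusion, coe_spReindex_apply, GelbartRogawski1991.UnitaryDualPair.toSp_apply,
    coe_spReindex_apply]
  simp only [reindexW_apply, reindexW_symm_apply]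
  refine Prod.ext (funext fun k => ?_) (funext fun k => ?_) <;>
    simp only [Function.comp_apply, Equiv.symm_trans_apply, Equiv.coe_trans, Function.comp_assoc]

/-- (ii) for the composite hom (private; split off for the heartbeat budget): the Sum-model action formula. [folklore] -/
private theorem inclusion_spReindex_apply_sumElim
    (hS : symplecticGroup (polar (Matrix.toLinearMap₂' (AdeleRing (𝓞 F) F) (Matrix.reindex
        (((Equiv.prodCongr (Equiv.refl (Fin N)) finSumFinEquiv.symm).trans (Equiv.prodSumDistrib (Fin N) (Fin 1) (Fin 1))).trans
          (Equiv.sumCongr e e))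
        (((Equiv.prodCongr (Equiv.refl (Fin N)) finSumFinEquiv.symm).trans (Equiv.prodSumDistrib (Fin N) (Fin 1) (Fin 1))).trans
          (Equiv.sumCongr e e))
        (TV.map (algebraMap F (AdeleRing (𝓞 F) F)) ⊗ₖ
          ((Matrix.reindex finSumFinEquiv finSumFinEquiv (Matrix.fromBlocks TW 0 0 (-TW))).map (algebraMap F (AdeleRing (𝓞 F) F))))))) ≤
      symplecticGroup (polar (Matrix.toLinearMap₂' (AdeleRing (𝓞 F) F)
        (Matrix.fromBlocks (GelbartRogawski1991.UnitaryDualPair.adelicGram F e TV TW) 0 0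
          (-GelbartRogawski1991.UnitaryDualPair.adelicGram F e TV TW)))))
    (A : adelic F E c (1 + 1) ((Matrix.reindex finSumFinEquiv finSumFinEquiv (Matrix.fromBlocks TW 0 0 (-TW))).map (algebraMap F E)))
    (P Q : Matrix (Fin (1 + 1)) (Fin (1 + 1)) (AdeleRing (𝓞 F) F))
    (hP : ((A : GL (Fin (1 + 1)) (AdeleRing (𝓞 E) E)) : Matrix (Fin (1 + 1)) (Fin (1 + 1)) (AdeleRing (𝓞 E) E)).map
      (QuadraticCoordinates.re (quadraticAdeleEquiv F E c hcδ hδ).toAddEquiv) = P)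
    (hQ : ((A : GL (Fin (1 + 1)) (AdeleRing (𝓞 E) E)) : Matrix (Fin (1 + 1)) (Fin (1 + 1)) (AdeleRing (𝓞 E) E)).map
      (QuadraticCoordinates.im (quadraticAdeleEquiv F E c hcδ hδ).toAddEquiv) = Q)
    (x₁ x₂ y₁ y₂ : Fin n → AdeleRing (𝓞 F) F) :
    ((Subgroup.inclusion hS (spReindex
          (((Equiv.prodCongr (Equiv.refl (Fin N)) finSumFinEquiv.symm).trans (Equiv.prodSumDistrib (Fin N) (Fin 1) (Fin 1))).trans
            (Equiv.sumCongr e e)) _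
          (adelicPairToSymplectic F E c N (1 + 1) hcδ hδ hd hV hW2 rfl rfl
            (adelicInr F E c N (1 + 1) (TV.map (algebraMap F E))
              ((Matrix.reindex finSumFinEquiv finSumFinEquiv (Matrix.fromBlocks TW 0 0 (-TW))).map (algebraMap F E)) A))) :
        symplecticGroup (polar (Matrix.toLinearMap₂' (AdeleRing (𝓞 F) F)
          (Matrix.fromBlocks (GelbartRogawski1991.UnitaryDualPair.adelicGram F e TV TW) 0 0
            (-GelbartRogawski1991.UnitaryDualPair.adelicGram F e TV TW))))) :
      ((Fin n ⊕ Fin n → AdeleRing (𝓞 F) F) × (Fin n ⊕ Fin n → AdeleRing (𝓞 F) F)) ≃ₗ[AdeleRing (𝓞 F) F]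
        ((Fin n ⊕ Fin n → AdeleRing (𝓞 F) F) × (Fin n ⊕ Fin n → AdeleRing (𝓞 F) F)))
        (Sum.elim x₁ x₂, Sum.elim y₁ y₂) =
      (Sum.elim (P 0 0 • x₁ + P 0 1 • x₂ + algebraMap F (AdeleRing (𝓞 F) F) d • (Q 0 0 • y₁ + Q 0 1 • y₂))
          (P 1 0 • x₁ + P 1 1 • x₂ + algebraMap F (AdeleRing (𝓞 F) F) d • (Q 1 0 • y₁ + Q 1 1 • y₂)),
        Sum.elim (Q 0 0 • x₁ + Q 0 1 • x₂ + (P 0 0 • y₁ + P 0 1 • y₂))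
          (Q 1 0 • x₁ + Q 1 1 • x₂ + (P 1 0 • y₁ + P 1 1 • y₂))) := by
  have h := spReindex_inclusion_spReindex_apply F E c hcδ hδ hd N e TW hV hW2 hS A
    (reindexW (AdeleRing (𝓞 F) F) (finSumFinEquiv : Fin n ⊕ Fin n ≃ Fin (n + n)) (Sum.elim x₁ x₂, Sum.elim y₁ y₂))
  rw [toSp_adelicInr_apply_reindexW_sumElim F E c hcδ hδ hd N e hV hW2 A P Q hP hQ x₁ x₂ y₁ y₂, coe_spReindex_apply,
    LinearEquiv.symm_apply_apply] at h
  exact (reindexW (AdeleRing (𝓞 F) F) (finSumFinEquiv : Fin n ⊕ Fin n ≃ Fin (n + n))).injective h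

/-- **The `W`-side of the doubled pair in the Sum model, as a homomorphism.**  There is `jS : U(T_W ⊕ −T_W)(𝔸_F) →* Sp𝕎₂ = Sp(T ⊕ −T)`
(`T = adelicGram F e T_V T_W`) such that (i) `spReindex finSumFinEquiv (T ⊕ −T) ∘ jS` IS the skeleton's pair embedding `ι_{eD}(1 ⊗ ·)`
(as automorphisms of `𝕎□_𝔸`), and (ii) `jS A` acts on `(Sum.elim x₁ x₂, Sum.elim y₁ y₂)` by the `E`-scalar matrix `(re_𝔸 A, im_𝔸 A)`.
[cite: GelbartRogawski1991, §3.1 p. 454] [cite: HarrisKudlaSweet1996, §1 (1.2)] -/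
theorem exists_sumModelHom :
    ∃ jS : adelic F E c (1 + 1) ((Matrix.reindex finSumFinEquiv finSumFinEquiv (Matrix.fromBlocks TW 0 0 (-TW))).map (algebraMap F E)) →*
        symplecticGroup (polar (Matrix.toLinearMap₂' (AdeleRing (𝓞 F) F)
          (Matrix.fromBlocks (GelbartRogawski1991.UnitaryDualPair.adelicGram F e TV TW) 0 0
            (-GelbartRogawski1991.UnitaryDualPair.adelicGram F e TV TW)))),
      (∀ (A : adelic F E c (1 + 1) ((Matrix.reindex finSumFinEquiv finSumFinEquiv (Matrix.fromBlocks TW 0 0 (-TW))).map (algebraMap F E)))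
          (v : (Fin (n + n) → AdeleRing (𝓞 F) F) × (Fin (n + n) → AdeleRing (𝓞 F) F)),
        ((spReindex (finSumFinEquiv : Fin n ⊕ Fin n ≃ Fin (n + n))
            (Matrix.fromBlocks (GelbartRogawski1991.UnitaryDualPair.adelicGram F e TV TW) 0 0
              (-GelbartRogawski1991.UnitaryDualPair.adelicGram F e TV TW)) (jS A) :
            symplecticGroup (polar (Matrix.toLinearMap₂' (AdeleRing (𝓞 F) F)
              (Matrix.reindex finSumFinEquiv finSumFinEquiv
                (Matrix.fromBlocks (GelbartRogawski1991.UnitaryDualPair.adelicGram F e TV TW) 0 0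
                  (-GelbartRogawski1991.UnitaryDualPair.adelicGram F e TV TW)))))) :
          ((Fin (n + n) → AdeleRing (𝓞 F) F) × (Fin (n + n) → AdeleRing (𝓞 F) F)) ≃ₗ[AdeleRing (𝓞 F) F]
            ((Fin (n + n) → AdeleRing (𝓞 F) F) × (Fin (n + n) → AdeleRing (𝓞 F) F))) v =
        ((GelbartRogawski1991.UnitaryDualPair.toSp F E c N (1 + 1)
            (((Equiv.prodCongr (Equiv.refl (Fin N)) finSumFinEquiv.symm).trans (Equiv.prodSumDistrib (Fin N) (Fin 1) (Fin 1))).trans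
              ((Equiv.sumCongr e e).trans finSumFinEquiv))
            (TV.map (algebraMap F E)) ((Matrix.reindex finSumFinEquiv finSumFinEquiv (Matrix.fromBlocks TW 0 0 (-TW))).map (algebraMap F E))
            hcδ hδ hd hV hW2 rfl rfl
            (adelicInr F E c N (1 + 1) (TV.map (algebraMap F E))
              ((Matrix.reindex finSumFinEquiv finSumFinEquiv (Matrix.fromBlocks TW 0 0 (-TW))).map (algebraMap F E)) A) :
            symplecticGroup (polar (Weil1964.adelicForm F (Fin (n + n))
              (GelbartRogawski1991.UnitaryDualPair.adelicGram F
                (((Equiv.prodCongr (Equiv.refl (Fin N)) finSumFinEquiv.symm).trans (Equiv.prodSumDistrib (Fin N) (Fin 1) (Fin 1))).trans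
                  ((Equiv.sumCongr e e).trans finSumFinEquiv)) TV
                (Matrix.reindex finSumFinEquiv finSumFinEquiv (Matrix.fromBlocks TW 0 0 (-TW))))))) :
          ((Fin (n + n) → AdeleRing (𝓞 F) F) × (Fin (n + n) → AdeleRing (𝓞 F) F)) ≃ₗ[AdeleRing (𝓞 F) F]
            ((Fin (n + n) → AdeleRing (𝓞 F) F) × (Fin (n + n) → AdeleRing (𝓞 F) F))) v) ∧
      ∀ (A : adelic F E c (1 + 1) ((Matrix.reindex finSumFinEquiv finSumFinEquiv (Matrix.fromBlocks TW 0 0 (-TW))).map (algebraMap F E)))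
        (P Q : Matrix (Fin (1 + 1)) (Fin (1 + 1)) (AdeleRing (𝓞 F) F)),
        ((A : GL (Fin (1 + 1)) (AdeleRing (𝓞 E) E)) : Matrix (Fin (1 + 1)) (Fin (1 + 1)) (AdeleRing (𝓞 E) E)).map
            (QuadraticCoordinates.re (quadraticAdeleEquiv F E c hcδ hδ).toAddEquiv) = P →
        ((A : GL (Fin (1 + 1)) (AdeleRing (𝓞 E) E)) : Matrix (Fin (1 + 1)) (Fin (1 + 1)) (AdeleRing (𝓞 E) E)).map
            (QuadraticCoordinates.im (quadraticAdeleEquiv F E c hcδ hδ).toAddEquiv) = Q →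
        ∀ x₁ x₂ y₁ y₂ : Fin n → AdeleRing (𝓞 F) F,
          ((jS A : symplecticGroup (polar (Matrix.toLinearMap₂' (AdeleRing (𝓞 F) F)
              (Matrix.fromBlocks (GelbartRogawski1991.UnitaryDualPair.adelicGram F e TV TW) 0 0
                (-GelbartRogawski1991.UnitaryDualPair.adelicGram F e TV TW))))) :
              ((Fin n ⊕ Fin n → AdeleRing (𝓞 F) F) × (Fin n ⊕ Fin n → AdeleRing (𝓞 F) F)) ≃ₗ[AdeleRing (𝓞 F) F]
                ((Fin n ⊕ Fin n → AdeleRing (𝓞 F) F) × (Fin n ⊕ Fin n → AdeleRing (𝓞 F) F)))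
              (Sum.elim x₁ x₂, Sum.elim y₁ y₂) =
            (Sum.elim (P 0 0 • x₁ + P 0 1 • x₂ + algebraMap F (AdeleRing (𝓞 F) F) d • (Q 0 0 • y₁ + Q 0 1 • y₂))
                (P 1 0 • x₁ + P 1 1 • x₂ + algebraMap F (AdeleRing (𝓞 F) F) d • (Q 1 0 • y₁ + Q 1 1 • y₂)),
              Sum.elim (Q 0 0 • x₁ + Q 0 1 • x₂ + (P 0 0 • y₁ + P 0 1 • y₂))
                (Q 1 0 • x₁ + Q 1 1 • x₂ + (P 1 0 • y₁ + P 1 1 • y₂))) := by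
  set E₁ : Fin N × Fin (1 + 1) ≃ Fin n ⊕ Fin n :=
    (((Equiv.prodCongr (Equiv.refl (Fin N)) finSumFinEquiv.symm).trans (Equiv.prodSumDistrib (Fin N) (Fin 1) (Fin 1))).trans
      (Equiv.sumCongr e e)) with hE₁
  set T := GelbartRogawski1991.UnitaryDualPair.adelicGram F e TV TW with hT
  -- the Gram identity transports `Sp(reindex E₁ E₁ (T_V ⊗ T_{W□}))` onto `Sp(T ⊕ −T)`
  have hG := reindex_doubledFrame_kronecker_eq_fromBlocks F N e TW (TV := TV)
  have hS : symplecticGroup (polar (Matrix.toLinearMap₂' (AdeleRing (𝓞 F) F) (Matrix.reindex E₁ E₁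
      (TV.map (algebraMap F (AdeleRing (𝓞 F) F)) ⊗ₖ
        ((Matrix.reindex finSumFinEquiv finSumFinEquiv (Matrix.fromBlocks TW 0 0 (-TW))).map (algebraMap F (AdeleRing (𝓞 F) F))))))) ≤
      symplecticGroup (polar (Matrix.toLinearMap₂' (AdeleRing (𝓞 F) F) (Matrix.fromBlocks T 0 0 (-T)))) := by
    rw [hE₁, hG]
  -- the hom: inclusion ∘ spReindex E₁ ∘ adelicPairToSymplectic ∘ adelicInr
  set jS : adelic F E c (1 + 1) ((Matrix.reindex finSumFinEquiv finSumFinEquiv (Matrix.fromBlocks TW 0 0 (-TW))).map (algebraMap F E)) →*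
      symplecticGroup (polar (Matrix.toLinearMap₂' (AdeleRing (𝓞 F) F) (Matrix.fromBlocks T 0 0 (-T)))) :=
    (Subgroup.inclusion hS).comp (((spReindex E₁ _).comp
      (adelicPairToSymplectic F E c N (1 + 1) hcδ hδ hd hV hW2 rfl rfl)).comp
      (adelicInr F E c N (1 + 1) (TV.map (algebraMap F E))
        ((Matrix.reindex finSumFinEquiv finSumFinEquiv (Matrix.fromBlocks TW 0 0 (-TW))).map (algebraMap F E)))) with hjS
  have hi := fun A v => by
    simpa only [hjS, MonoidHom.comp_apply] using spReindex_inclusion_spReindex_apply F E c hcδ hδ hd N e TW hV hW2 hS A v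
  refine ⟨jS, hi, fun A P Q hP hQ x₁ x₂ y₁ y₂ => ?_⟩
  -- (ii): ★ `toSp_adelicInr_apply_reindexW_sumElim` read through (i) and the injectivity of `reindexW finSumFinEquiv`
  simpa only [hjS, MonoidHom.comp_apply] using
    inclusion_spReindex_apply_sumElim F E c hcδ hδ hd N e TW hV hW2 hS A P Q hP hQ x₁ x₂ y₁ y₂

end SumModel

end UnitaryGroup

end Literature.NumberTheory.Automorphic

end
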